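import Summits.CriticalPhenomena.PercolationContinuityZ3.Theorems.PercNearOneGluingNoHeavyQuantFarSunWeakestBet
import Summits.CriticalPhenomena.PercolationContinuityZ3.Theorems.PercNearOneGluingNoHeavyQuantFarSunWitnessAvg
import Summits.CriticalPhenomena.PercolationContinuityZ3.Theorems.PercNearOneGluingNoHeavyQuantFarSunRowLeTen
import HarnessLib

/-!
# FAR beyond trees: LAYER TWO FOR ALL `K` — `SunFAR K 2` for every `K ≥ 2`, conditionally on the single inequality (S-avg)

builds on p205010 (kernel theorem, internal audit signed; external expert review pending)

Support file (`--supports stmt-CriticalPhenomena-4575`), seat `prim-cert-1` (gen 37); memos `prim-cert-1/FROM-prim-cert-1-g35-FRAME-COVERING.md` §0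
and `prim-cert-1/FROM-prim-cert-1-g37-SURPLUS-FAR.md` §4.  The all-`K` programme for the second layer of FAR on hairy cycles
(`HairyCycle.SunFAR K 2`) is assembled here from kernel theorems: `K ≤ 10` is `HairyCycle.sunFAR_of_le_ten` (sun certificates); for
`K ≥ 11`, `HairyCycle.sunFAR_of_hairCert_lowWitAvg` (p376210: the universal-witness certificate with the averaged kernel serves whenever its weight
`G_avg = witGavg K h 2 ≥ 1`) together with THM B `HairyCycle.hairCert_of_weakestBet` (the weakest-hair bet serves whenever `η(Σ−4) ≤ 2(F−η)`)
reduce everything to ONE explicit inequality, the hypothesis `(S-avg)` below: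

  **(S-avg)**: for `K ≥ 11`, hair weights `h ∈ [0,1]` on `range K` with least weight `η = h m`, `Σ = Σ_{k<K} h k > 4` and
  `F = hairV K h 2 (range K)`:  `2(F − η) < η(Σ − 4)  ⟹  witGavg K h 2 ≥ 1`.

Numerically (memo g35 §0(v), §4): zero violations in exhaustive grids at `K = 10, 11, 12, 13` (30–180 million points each) and adversarially up
to `K = 30`; the bulk slack grows super-linearly in `K` (memo g37 §2).  It is the only remaining conjectured input of "layer 2 for all `K`".

* `HairyCycle.sunMarg_le_h` — `sunMarg K g h k ≤ h k` (so `EN > 4` forces `Σ h > 4`); `HairyCycle.hairV_congr`, `HairyCycle.cert_iff_of_eqOn` —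
  the certificate rows only see `h` on `range K` (truncation).
* **`HairyCycle.sunFAR_two_of_witGavg_from`** — `(S-avg) from K₁ on → ∀ K ≥ K₁, SunFAR K 2` (`K₁ ≥ 2`; the form in which a proof of (S-avg) for
  all LARGE `K` is used);  **`HairyCycle.sunFAR_two_of_witGavg`** — `(S-avg) from 11 on → ∀ K ≥ 2, SunFAR K 2`.
No definitions, no sorries, standard axioms.  [this work]
[cite: KozmaNitzan2024, Conjecture 3 (p. 15)] (context: the lower-tail family FAR serves).
-/

noncomputable section

namespace Summit.CriticalPhenomena.PercolationContinuityZ3.Theorems.HairyCycle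

open Finset
open scoped Classical

variable {K : ℕ}

/-! ## Marginals are at most the hair weights -/

/-- `sunMarg K g h k ≤ h k` for `g ∈ [0,1]`, `h k ≥ 0`, `k < K` (`K ≥ 2`): the arc mass covering `k` is at most one. [this work] -/
theorem sunMarg_le_h (hK : 2 ≤ K) {g : ℕ → ℝ} (hg : ∀ m, m ≤ K → 0 ≤ g m ∧ g m ≤ 1) {h : ℕ → ℝ} {k : ℕ} (hk : k < K)
    (hhk : 0 ≤ h k) : sunMarg K g h k ≤ h k := by
  rw [← sum_arcW_ite_mem_cov hK hg h hk]
  have h1 : ∑ p ∈ arcIx K, arcW K g p.1 p.2 * (if k ∈ cov K p.1 p.2 then (1 : ℝ) else 0) ≤ 1 := by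
    calc ∑ p ∈ arcIx K, arcW K g p.1 p.2 * (if k ∈ cov K p.1 p.2 then (1 : ℝ) else 0)
        ≤ ∑ p ∈ arcIx K, arcW K g p.1 p.2 :=
          Finset.sum_le_sum fun p _ => by
            have := arcW_nonneg hg p.1 p.2
            split_ifs <;> nlinarith
      _ = 1 := sum_arcW_eq_one g
  nlinarith

/-! ## The certificate only sees the weights on `range K` -/

/-- `hairW` only depends on `h` restricted to `range K`. [this work] -/
theorem hairW_congr {h h' : ℕ → ℝ} (he : ∀ k, k < K → h' k = h k) (Q : Finset ℕ) : hairW K h' Q = hairW K h Q := by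
  unfold hairW
  exact Finset.prod_congr rfl fun k hk => by rw [he k (Finset.mem_range.1 hk)]

/-- `hairV` only depends on `h` restricted to `range K`. [this work] -/
theorem hairV_congr {h h' : ℕ → ℝ} (he : ∀ k, k < K → h' k = h k) (j : ℕ) (C : Finset ℕ) : hairV K h' j C = hairV K h j C := by
  unfold hairV
  exact Finset.sum_congr rfl fun Q _ => by rw [hairW_congr he Q]

/-- Sums over a coverage set only see `h` on `range K`. [this work] -/
theorem sum_cov_congr {h h' : ℕ → ℝ} (he : ∀ k, k < K → h' k = h k) (f : ℕ → ℝ → ℝ) (l l' : ℕ) :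
    ∑ k ∈ cov K l l', f k (h' k) = ∑ k ∈ cov K l l', f k (h k) :=
  Finset.sum_congr rfl fun k hk => by rw [he k (mem_cov.1 hk).1]

/-! ## The assembly -/

/-- **LAYER TWO FROM `K₁` ON, CONDITIONALLY ON (S-avg) FROM `K₁` ON** (`K₁ ≥ 2`).  If for every `K ≥ K₁` and every `h ∈ [0,1]` on `range K`
with least weight `η = h m` (`m < K`) the strict inequality `2(F − η) < η(Σ_{k<K} h k − 4)` (`F = hairV K h 2 (range K)`) forces `witGavg K h 2 ≥ 1`,
then `SunFAR K 2` holds for every `K ≥ K₁`: by `sunFAR_of_hairCert_lowWitAvg`, the regime `witGavg < 1` being covered by THM B (`hairCert_of_weakestBet`)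
since there `η(Σ−4) ≤ 2(F−η)` by hypothesis. [this work] -/
theorem sunFAR_two_of_witGavg_from (K₁ : ℕ) (hK₁ : 2 ≤ K₁)
    (hS : ∀ K : ℕ, K₁ ≤ K → ∀ h : ℕ → ℝ, (∀ k, k < K → 0 ≤ h k ∧ h k ≤ 1) → ∀ m : ℕ, m < K → (∀ k, k < K → h m ≤ h k) →
      (4 : ℝ) < ∑ k ∈ range K, h k → 2 * (hairV K h 2 (range K) - h m) < h m * (∑ k ∈ range K, h k - 4) → 1 ≤ witGavg K h 2) :
    ∀ K : ℕ, K₁ ≤ K → SunFAR K 2 := by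
  intro K hK
  have hK2 : 2 ≤ K := le_trans hK₁ hK
  refine sunFAR_of_hairCert_lowWitAvg hK2 fun g h hg hh hEN hGlt => ?_
  -- `Σ h > 4`
  have hS4 : (4 : ℝ) < ∑ k ∈ range K, h k := by
    have h1 : ∑ k ∈ range K, sunMarg K g h k ≤ ∑ k ∈ range K, h k :=
      Finset.sum_le_sum fun k hk => sunMarg_le_h hK2 hg (Finset.mem_range.1 hk) (hh k (Finset.mem_range.1 hk)).1
    have h2 : (2 * (2 : ℕ) : ℝ) = 4 := by norm_num
    linarith [h2 ▸ hEN]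
  -- a least weight
  obtain ⟨m, hmK, hmin⟩ := Finset.exists_min_image (range K) h ⟨0, Finset.mem_range.2 (by omega)⟩
  have hm : m < K := Finset.mem_range.1 hmK
  have hmin' : ∀ k, k < K → h m ≤ h k := fun k hk => hmin k (Finset.mem_range.2 hk)
  -- in the regime `R` the averaged witness weight would be `≥ 1`: contradiction; so THM B's hypothesis holds
  have hB : h m * (∑ k ∈ range K, h k - 4) ≤ 2 * (hairV K h 2 (range K) - h m) := by
    by_contra hR
    push Not at hR
    exact absurd (hS K hK h hh m hm hmin' hS4 hR) (not_le.2 hGlt)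
  -- truncate `h` outside `range K` and apply THM B
  set h' : ℕ → ℝ := fun k => if k < K then h k else 0 with hh'def
  have he : ∀ k, k < K → h' k = h k := fun k hk => by rw [hh'def]; simp only [hk, if_true]
  have hh' : ∀ k, 0 ≤ h' k ∧ h' k ≤ 1 := by
    intro k
    by_cases hk : k < K
    · rw [he k hk]; exact hh k hk
    · rw [hh'def]; simp only [hk, if_false]; norm_num
  have hsum : ∑ k ∈ range K, h' k = ∑ k ∈ range K, h k :=
    Finset.sum_congr rfl fun k hk => he k (Finset.mem_range.1 hk)
  have hF : hairV K h' 2 (range K) = hairV K h 2 (range K) := hairV_congr he 2 (range K)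
  obtain ⟨lam, μ, hlam, hlam1, hμ, hrows⟩ := hairCert_of_weakestBet (K := K) hh' (by rw [hsum]; exact hS4) hm
    (fun k hk => by rw [he m hm, he k hk]; exact hmin' k hk) (by rw [hsum, hF, he m hm]; exact hB)
  refine ⟨lam, μ, hlam, hlam1, hμ, fun p hp => ?_⟩
  have hr := hrows p hp
  rw [hairV_congr he 2, sum_cov_congr he (fun k x => lam k * x), sum_cov_congr he (fun _ x => x)] at hr
  exact hr

/-- **LAYER TWO FOR ALL `K`, CONDITIONALLY ON (S-avg).**  If for every `K ≥ 11` and every `h ∈ [0,1]` on `range K` with least weight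
`η = h m` (`m < K`) the strict inequality `2(F − η) < η(Σ_{k<K} h k − 4)` (`F = hairV K h 2 (range K)`) forces `witGavg K h 2 ≥ 1`, then
`SunFAR K 2` holds for every `K ≥ 2`:  `K ≤ 10` by the sun certificates (`sunFAR_of_le_ten`), `K ≥ 11` by `sunFAR_two_of_witGavg_from`. [this work] -/
theorem sunFAR_two_of_witGavg
    (hS : ∀ K : ℕ, 11 ≤ K → ∀ h : ℕ → ℝ, (∀ k, k < K → 0 ≤ h k ∧ h k ≤ 1) → ∀ m : ℕ, m < K → (∀ k, k < K → h m ≤ h k) →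
      (4 : ℝ) < ∑ k ∈ range K, h k → 2 * (hairV K h 2 (range K) - h m) < h m * (∑ k ∈ range K, h k - 4) → 1 ≤ witGavg K h 2) :
    ∀ K : ℕ, 2 ≤ K → SunFAR K 2 := by
  intro K hK2
  by_cases hK10 : K ≤ 10
  · exact sunFAR_of_le_ten hK2 hK10 2
  · exact sunFAR_two_of_witGavg_from 11 (by norm_num) hS K (by omega)

end Summit.CriticalPhenomena.PercolationContinuityZ3.Theorems.HairyCycle

end
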